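import Summits.FinalStateConjecture.FinalStateConjecture.Theorems.ZeroEnergyKerrOrBombStationaryLimitReductionRecutCoveringJunctionCore
import Summits.FinalStateConjecture.FinalStateConjecture.Theorems.ZeroEnergyKerrOrBombStationaryLimitReductionKerrIsometryRigidityWave3EndTopology
import Summits.FinalStateConjecture.FinalStateConjecture.Theorems.BartnikGapSettlingGapExhaustionChartSegmentChronological
import Literature.Geometry.Lorentzian.BackgroundChartCalculus
import Literature.Geometry.Lorentzian.MinkowskiGlobalHyperbolicity
import HarnessLib

/-!
# Route ZeroEnergyKerrOrBomb · crux `FinalStateFromKerrOrBomb` (stmt-FinalStateConjecture-17839), line `SketchIdeator1` —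
# stub `stub_recutJunctionCoreB` (m5, boost-honest junction core), wave 8: the two inputs of Step F (flat steering) —
# pointwise flat time lines, and the DEEP APPROXIMANT of the first exit of a lab vertical

Helper file (`--supports stmt-FinalStateConjecture-17839`; registered helpers `recutJunction_flatTimeLine_point`,
`recutJunction_deepApproximant`) of the lead's wave-8 stub worker W21 (2026-08-17). Plan `work/stubs/W17-boost-audit.md`
§7.2 Step F; report `work/stubs/W21-report.md`. Companions (same wave): `…RecutCoreBFlatSteer2.lean` (Step F itself,
`recutJunction_flatSteer_boost`) and `…RecutCoreBAssembly.lean` (the assembly `recutJunctionCoreB_of_bricks`).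

Content.
* `recutJunction_flatTimeLine_point` (§1): for a stationary decomposition `d` satisfying the flat orientation clause (iii) of
  `IsOrientationCompatible` there is a lab time `τF > τ₀` such that for every vertical coordinate segment
  `{y + s e₀ : 0 ≤ s ≤ S} ⊆ U₀` with `y⁰ ≥ τF` the flat chart point of `y` lies in `J⁻` of the flat chart point of `y + S e₀`
  (the POINTWISE form of the flat time-line brick p143586, whose registered text only records the slab form; §1 is a private
  copy of its internals: `C⁰` pinching makes `dΨ₀(e₀)` timelike, clause (iii) makes it future, the tree's chart-segment glue
  `stub_chartSegment_chronological` integrates).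
* `recutJunction_deepApproximant` (§3): the deep-exit plumbing of Step F in the ONE-APPROXIMANT form that Step F consumes, with
  the neighbour brick B3 taken in its landed DEEP form (`recutJunction_farFlat_deep`, p154085) — the accepted deep-exit lemma
  `recutJunction_deepExit` (p153924) asks B3 in a certified-only form that p154085 does not supply, so the plumbing is re-proved
  here against the landed text. Hypotheses (binders of `SigM.stub_recutJunctionCoreB` verbatim): monotone radii, the
  coordinate deepness clause (iii-c), Kerr identifications, the certified agreement clause (a_R), (e⁺); then, as hypotheses,
  the conclusions of B1b (`timeᵢ ≤ lab + |cᵢ⁰| + 1` on lab-late certified coordinates, p153600), of the lateness transfer B1c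
  (p153600) and of B3 (p154085). Conclusion: for margins `s₀, W₀ ≥ 0` and requests `T*, R*` there is a lab time `T > τ₀` such
  that whenever the lab vertical `t ↦ y + t e₀`, `0 ≤ t ≤ τ₁ − y⁰`, from a flat coordinate `y` with `T ≤ y⁰ ≤ τ₁` leaves `U₀`,
  there are a hole `i`, a parameter `t ≥ 0` with `y⁰ + t ≤ τ₁` and the whole segment `[0, t]` inside `U₀`, and a Kerr–Schild
  point `x ∈ Kerr.exterior` with `Pᵢ Θᵢ x = y + t e₀`, `r(x) ≥ R*`, `(Θᵢ x)⁰ ≥ T*`, DEEP `Aᵢ.radius (Θᵢ x) ≤ Rᵢ((Θᵢ x)⁰ − s₀) − W₀`,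
  `(Θᵢ x)⁰ ≤ y⁰ + t + |cᵢ⁰| + 1`, at which the hole chart and the flat chart AGREE. Mechanism: first exit `tₑ` (infimum);
  (iii-c) at margins `(s₀ + 2, W₀ + W_B + 2C + 1)` makes the exit deep for some hole `i`; the approximant `t := tₑ − η`,
  `η = min (1/(‖Λᵢ⁻¹e₀‖ + 1)) tₑ`, has rest-frame preimage within distance `1` of that of the exit, hence is deep at the B3
  margins and at `(s₀, W₀)`; it is a late flat coordinate, hence ((e⁺)) a d.o.c.-part coordinate `Pᵢ Θᵢ x`, far by B3, late by
  B1c, with `(Θᵢ x)⁰` bounded by B1b, and (a_R) applies. No limit / closure argument, no isochrony, no orthochrony.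

Elementary; no named fact, nothing restated. References: O'Neill 1983, Ch. 5, Lemma 5.29, Ch. 14, pp. 402–403;
Dafermos–Luk arXiv:1710.01722, Conjecture 1 (b)–(c) (late-time multi-chart bookkeeping; formalisation-internal).
-/

set_option linter.dupNamespace false
set_option maxSynthPendingDepth 3

noncomputable section

open scoped Manifold ContDiff Topology ENNReal
open Set Filter Function

namespace Summit.FinalStateConjecture.FinalStateConjecture.Theorems.SymplecticDualOfTheBomb

open Literature.Geometry.Lorentzian Summit.FinalStateConjecture.FinalStateConjecture.Theorems.OneLockedExplosion

/-! ## §1 Flat time lines, pointwise form (private copies of the internals of p143586, module unbuilt today) -/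

section Line

variable (𝓢 : Spacetime.{0} 4)

/-- If the `Cᵏ` deviation of `ψ^* g` from `g₀` on the truncated slab `{t = τ, r ≤ R}` is `< ε`, then at every point of that
slab `g(dψ w, dψ w) ≤ g₀(x)(w, w) + ε ‖w‖²`. [folklore] -/
private theorem val_mfderiv_le_of_truncDeviationCk_lt_w8 (B : ModelBackground) (ψ : B.domain → 𝓢.carrier) {k : ℕ}
    {R τ ε : ℝ} (hε : 0 < ε) (h : 𝓢.truncDeviationCk B ψ k R τ < ENNReal.ofReal ε) {x : B.domain}
    (hx : x ∈ B.truncTimeSlab R τ) (w : E4) :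
    𝓢.metric.val (ψ x) (mfderiv 𝓘(ℝ, E4) (𝓡 4) ψ x w) (mfderiv 𝓘(ℝ, E4) (𝓡 4) ψ x w) ≤
      B.bilin x.1 w w + ε * (‖w‖ * ‖w‖) := by
  -- private copy of `val_mfderiv_le_of_truncDeviationCk_lt_w4` (…RecutPastBoundaryFlat, p143586, unbuilt today)
  have h1 : ‖𝓢.deviation B ψ x‖ < ε := by
    have h2 := enorm_iteratedFDeriv_le_supCkENorm (Nat.zero_le k) (mem_image_of_mem Subtype.val hx)
      (𝓢.deviationExtend B ψ)
    rw [← ofReal_norm, norm_iteratedFDeriv_zero, 𝓢.deviationExtend_coe] at h2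
    exact (ENNReal.ofReal_lt_ofReal_iff hε).1 (h2.trans_lt h)
  have h3 : |𝓢.deviation B ψ x w w| ≤ ‖𝓢.deviation B ψ x‖ * ‖w‖ * ‖w‖ := by
    rw [← Real.norm_eq_abs]; exact (𝓢.deviation B ψ x).le_opNorm₂ w w
  have h4 := 𝓢.deviation_apply B ψ x w w
  have h6 : ‖𝓢.deviation B ψ x‖ * ‖w‖ * ‖w‖ ≤ ε * (‖w‖ * ‖w‖) := by
    rw [mul_assoc]; exact mul_le_mul_of_nonneg_right h1.le (mul_nonneg (norm_nonneg w) (norm_nonneg w))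
  linarith [(abs_le.1 h3).2]

/-- If the `Cᵏ` deviation of `ψ^* g` from `η` on the flat slab `{x⁰ = τ} ∩ U` is `< ½`, then `dψ(∂₀)` is timelike at every
point of that slab (`η(e₀, e₀) = −1`, `‖e₀‖ = 1`). [folklore] -/
private theorem isTimelike_flat_of_deviationCk_lt_w8 {U : TopologicalSpace.Opens E4}
    (ψ : (Minkowski.backgroundOn U).domain → 𝓢.carrier) {k : ℕ} {τ : ℝ}
    (h : 𝓢.deviationCk (Minkowski.backgroundOn U) ψ k τ < ENNReal.ofReal (1 / 2))
    {y : (Minkowski.backgroundOn U).domain} (hy : y ∈ (Minkowski.backgroundOn U).timeSlab τ) :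
    𝓢.metric.IsTimelike (mfderiv 𝓘(ℝ, E4) (𝓡 4) ψ y (E4.basisVector 0)) := by
  -- private copy of `isTimelike_flat_of_deviationCk_lt` (…RecutPastBoundaryFlat, p143586, unbuilt today)
  have hε : (0 : ℝ) < 1 / 2 := by norm_num
  have hy' : y ∈ (Minkowski.backgroundOn U).truncTimeSlab ((Minkowski.backgroundOn U).radius y.1) τ := ⟨hy, le_rfl⟩
  have h2 := val_mfderiv_le_of_truncDeviationCk_lt_w8 𝓢 (Minkowski.backgroundOn U) ψ hε
    ((𝓢.truncDeviationCk_le_deviationCk (Minkowski.backgroundOn U) ψ k _ τ).trans_lt h) hy' (E4.basisVector 0)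
  have h3 : (Minkowski.backgroundOn U).bilin y.1 (E4.basisVector 0) (E4.basisVector 0) = -1 :=
    Minkowski.bilin_basisVector_zero
  have h4 : ‖E4.basisVector 0‖ = 1 := by simp [E4.basisVector]
  rw [h3, h4] at h2
  exact h2.trans_lt (by norm_num)

/-- **Flat time lines are eventually future timelike** (chronological form): for a smooth chart `ψ` on the open `U ⊆ E4`
whose full `Cᵏ` deviation from `η` on the flat slabs tends to `0` and which satisfies the orientation clause (iii) after
`τ₀`, there is `τF > τ₀` such that the chart point of `y + S e₀` (`S > 0`, `y⁰ ≥ τF`, segment inside `U`) lies in `I⁺` of the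
chart point of `y`. O'Neill 1983, Ch. 14, pp. 402–403. [folklore] -/
private theorem flatTimeLine_mem_chronologicalFuture_w8 {U : TopologicalSpace.Opens E4}
    (ψ : (Minkowski.backgroundOn U).domain → 𝓢.carrier) (hψ : ContMDiff 𝓘(ℝ, E4) (𝓡 4) ∞ ψ) {k : ℕ}
    (hdev : Tendsto (fun τ ↦ 𝓢.deviationCk (Minkowski.backgroundOn U) ψ k τ) atTop (𝓝 0)) {τ₀ : ℝ}
    (hor : ∀ y : (Minkowski.backgroundOn U).domain, τ₀ < (y : E4) 0 →
      𝓢.metric.IsTimelike (mfderiv 𝓘(ℝ, E4) (𝓡 4) ψ y (E4.basisVector 0)) →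
        𝓢.timeOrientation.IsFutureDirected (mfderiv 𝓘(ℝ, E4) (𝓡 4) ψ y (E4.basisVector 0))) :
    ∃ τF : ℝ, τ₀ < τF ∧ ∀ (y : E4) (S : ℝ), τF ≤ y 0 → 0 < S →
      (∀ s ∈ Icc (0 : ℝ) S, y + s • E4.basisVector 0 ∈ (U : Set E4)) →
      ∀ (h₀ : y ∈ (U : Set E4)) (h₁ : y + S • E4.basisVector 0 ∈ (U : Set E4)),
        ψ ⟨y + S • E4.basisVector 0, h₁⟩ ∈ 𝓢.metric.chronologicalFuture 𝓢.timeOrientation {ψ ⟨y, h₀⟩} := by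
  -- private copy of `flatTimeLine_mem_chronologicalFuture` (…RecutPastBoundaryFlat, p143586, unbuilt today)
  have hε : (0 : ℝ) < 1 / 2 := by norm_num
  obtain ⟨T, hT⟩ := Filter.eventually_atTop.1 (hdev.eventually (gt_mem_nhds (ENNReal.ofReal_pos.2 hε)))
  refine ⟨max T τ₀ + 1, by linarith [le_max_right T τ₀], fun y S hy hS hseg h₀ h₁ ↦ ?_⟩
  set v : E4 := E4.basisVector 0 with hv
  have htime : ∀ s : ℝ, (y + s • v) 0 = y 0 + s := fun s ↦ by simp [hv, E4.basisVector]
  have hTs : ∀ s : ℝ, 0 ≤ s → T ≤ (y + s • v) 0 := fun s hs ↦ by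
    rw [htime]; linarith [le_max_left T τ₀]
  have hτ₀s : ∀ s : ℝ, 0 ≤ s → τ₀ < (y + s • v) 0 := fun s hs ↦ by
    rw [htime]; linarith [le_max_right T τ₀]
  have htl : ∀ s (hs : s ∈ Icc (0 : ℝ) S),
      𝓢.metric.IsTimelike (mfderiv 𝓘(ℝ, E4) (𝓡 4) ψ ⟨y + s • v, hseg s hs⟩ v) := fun s hs ↦
    isTimelike_flat_of_deviationCk_lt_w8 𝓢 ψ (hT _ (hTs s hs.1)) (show (y + s • v) 0 = (y + s • v) 0 from rfl)
  have hfut : ∀ s (hs : s ∈ Icc (0 : ℝ) S),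
      𝓢.timeOrientation.IsFutureDirected (mfderiv 𝓘(ℝ, E4) (𝓡 4) ψ ⟨y + s • v, hseg s hs⟩ v) := fun s hs ↦
    hor ⟨y + s • v, hseg s hs⟩ (hτ₀s s hs.1) (htl s hs)
  set y₀ : (Minkowski.backgroundOn U).domain := ⟨y, h₀⟩ with hy₀
  set Φ : E4 → 𝓢.carrier := ψ ∘ (chartAt E4 y₀).symm with hΦ
  have hΦq : ∀ (q : E4) (hq : q ∈ ((Minkowski.backgroundOn U).domain : Set E4)), Φ q = ψ ⟨q, hq⟩ := fun q hq ↦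
    congrFun (Spacetime.comp_chartAt_symm_comp_subtypeVal ψ y₀) ⟨q, hq⟩
  have hmd : ∀ s (hs : s ∈ Icc (0 : ℝ) S), MDifferentiableAt 𝓘(ℝ, E4) (𝓡 4) ψ ⟨y + s • v, hseg s hs⟩ := fun s _ ↦
    hψ.mdifferentiableAt (by simp)
  have hI := stub_chartSegment_chronological 𝓢 Φ ((Minkowski.backgroundOn U).domain : Set E4) y v S
    (Minkowski.backgroundOn U).domain.isOpen (𝓢.contMDiffOn_comp_chartAt_symm (Minkowski.backgroundOn U) ψ y₀ hψ)
    hS (fun s hs ↦ hseg s hs)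
    (fun s hs ↦ by
      rw [𝓢.metricInCoords_comp_chartAt_symm_apply (Minkowski.backgroundOn U) ψ y₀ (hseg s hs) (hmd s hs)]
      exact htl s hs)
    (fun s hs ↦ by
      rw [𝓢.mfderiv_comp_chartAt_symm_apply (Minkowski.backgroundOn U) ψ y₀ (hseg s hs) (hmd s hs),
        hΦq _ (hseg s hs)]
      exact hfut s hs)
  rw [hΦq (y + S • v) h₁, hΦq y h₀] at hI
  exact hI

/-- **Causal, pointwise form**: under the same hypotheses, for `S ≥ 0` the chart point of `y` lies in the causal past of the
chart point of `y + S e₀`. O'Neill 1983, Ch. 14, pp. 402–403. [folklore] -/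
private theorem flatTimeLine_mem_causalPast_w8 {U : TopologicalSpace.Opens E4}
    (ψ : (Minkowski.backgroundOn U).domain → 𝓢.carrier) (hψ : ContMDiff 𝓘(ℝ, E4) (𝓡 4) ∞ ψ) {k : ℕ}
    (hdev : Tendsto (fun τ ↦ 𝓢.deviationCk (Minkowski.backgroundOn U) ψ k τ) atTop (𝓝 0)) {τ₀ : ℝ}
    (hor : ∀ y : (Minkowski.backgroundOn U).domain, τ₀ < (y : E4) 0 →
      𝓢.metric.IsTimelike (mfderiv 𝓘(ℝ, E4) (𝓡 4) ψ y (E4.basisVector 0)) →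
        𝓢.timeOrientation.IsFutureDirected (mfderiv 𝓘(ℝ, E4) (𝓡 4) ψ y (E4.basisVector 0))) :
    ∃ τF : ℝ, τ₀ < τF ∧ ∀ (y : E4) (S : ℝ), τF ≤ y 0 → 0 ≤ S →
      (∀ s ∈ Icc (0 : ℝ) S, y + s • E4.basisVector 0 ∈ (U : Set E4)) →
      ∀ (h₀ : y ∈ (U : Set E4)) (h₁ : y + S • E4.basisVector 0 ∈ (U : Set E4)),
        ψ ⟨y, h₀⟩ ∈ 𝓢.metric.causalPast 𝓢.timeOrientation {ψ ⟨y + S • E4.basisVector 0, h₁⟩} := by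
  -- private copy of `flatTimeLine_mem_causalPast` (…RecutPastBoundaryFlat, p143586, unbuilt today)
  obtain ⟨τF, hτF, h⟩ := flatTimeLine_mem_chronologicalFuture_w8 𝓢 ψ hψ hdev hor
  refine ⟨τF, hτF, fun y S hy hS hseg h₀ h₁ ↦ ?_⟩
  rcases hS.eq_or_lt with rfl | hS'
  · have hpt : (⟨y + (0 : ℝ) • E4.basisVector 0, h₁⟩ : (Minkowski.backgroundOn U).domain) = ⟨y, h₀⟩ := by
      apply Subtype.ext; simp
    rw [hpt]
    exact LorentzianMetric.subset_causalPast _ _ _ (mem_singleton _)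
  · exact LorentzianMetric.mem_causalPast_of_mem_causalFuture
      (LorentzianMetric.chronologicalFuture_subset_causalFuture _ _ _ (h y S hy hS' hseg h₀ h₁))

end Line

/-- **Registered helper `recutJunction_flatTimeLine_point` (flat time lines, POINTWISE form; input of Step F).** For a
stationary decomposition `d` satisfying the flat orientation clause (iii) of `IsOrientationCompatible` there is a lab time
`τF > τ₀` such that for every `y : E4` with `τF ≤ y⁰`, every `S ≥ 0` and every vertical coordinate segment
`{y + s e₀ : 0 ≤ s ≤ S} ⊆ U₀`, the flat chart point of `y` lies in `J⁻` of the flat chart point of `y + S e₀`.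
O'Neill 1983, Ch. 14, pp. 402–403. [folklore] -/
theorem recutJunction_flatTimeLine_point : ∀ {𝓢 : Spacetime.{0} 4} {O : Set 𝓢.carrier} {k : ℕ} (d : StationaryFinalStateDecomposition 𝓢 O k), (∀ y : d.toOver.flatDomain, d.toOver.τ₀ < (y : E4) 0 → 𝓢.metric.IsTimelike (mfderiv 𝓘(ℝ, E4) (𝓡 4) d.toOver.flatChart y (E4.basisVector 0)) → 𝓢.timeOrientation.IsFutureDirected (mfderiv 𝓘(ℝ, E4) (𝓡 4) d.toOver.flatChart y (E4.basisVector 0))) → ∃ τF : ℝ, d.toOver.τ₀ < τF ∧ ∀ (y : E4) (S : ℝ), τF ≤ y 0 → 0 ≤ S → (∀ s ∈ Set.Icc (0 : ℝ) S, y + s • E4.basisVector 0 ∈ (d.toOver.flatDomain : Set E4)) → ∀ (h₀ : y ∈ (d.toOver.flatDomain : Set E4)) (h₁ : y + S • E4.basisVector 0 ∈ (d.toOver.flatDomain : Set E4)), d.toOver.flatChart ⟨y, h₀⟩ ∈ 𝓢.metric.causalPast 𝓢.timeOrientation {d.toOver.flatChart ⟨y + S • E4.basisVector 0, h₁⟩}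 := by
  intro 𝓢 O k d hor
  exact flatTimeLine_mem_causalPast_w8 𝓢 (U := d.toOver.flatDomain) d.toOver.flatChart
    d.toOver.isLateChart_flat.contMDiff (k := k) d.toOver.tendsto_deviationCk_flat hor

/-! ## §2 First exit of a coordinate segment from an open set -/

/-- **First exit** of the segment `t ↦ y + t e₀`, `t ∈ [0, b]`, from the open set `U ∋ y`: a parameter `tₑ ∈ (0, b]` with
`y + t e₀ ∈ U` on `[0, tₑ)` and `y + tₑ e₀ ∉ U` (infimum of the closed set of bad parameters). [folklore] -/
private theorem exists_firstExit_w8 {U : Set E4} (hU : IsOpen U) {y : E4} (hy : y ∈ U) {b : ℝ}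
    (h : ∃ t ∈ Icc (0 : ℝ) b, y + t • E4.basisVector 0 ∉ U) :
    ∃ tₑ : ℝ, 0 < tₑ ∧ tₑ ≤ b ∧ (∀ t ∈ Ico (0 : ℝ) tₑ, y + t • E4.basisVector 0 ∈ U) ∧
      y + tₑ • E4.basisVector 0 ∉ U := by
  -- private copy of `exists_firstExit` (…RecutCoreBDeepExit, p153924, unbuilt today)
  have hc : Continuous fun t : ℝ ↦ y + t • E4.basisVector 0 := by fun_prop
  set F : Set ℝ := Icc (0 : ℝ) b ∩ {t | y + t • E4.basisVector 0 ∉ U} with hF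
  have hFc : IsClosed F := isClosed_Icc.inter ((hU.preimage hc).isClosed_compl)
  obtain ⟨t₀, ht₀, ht₀U⟩ := h
  have hne : F.Nonempty := ⟨t₀, ht₀, ht₀U⟩
  have hbdd : BddBelow F := ⟨0, fun t ht ↦ ht.1.1⟩
  have hmem : sInf F ∈ F := hFc.csInf_mem hne hbdd
  refine ⟨sInf F, ?_, hmem.1.2, fun t ht ↦ ?_, hmem.2⟩
  · rcases hmem.1.1.eq_or_lt with h0 | h0
    · exfalso
      have h1 : y + sInf F • E4.basisVector 0 ∉ U := hmem.2
      rw [← h0, zero_smul, add_zero] at h1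
      exact h1 hy
    · exact h0
  · by_contra hbad
    have h1 : sInf F ≤ t := csInf_le hbdd ⟨⟨ht.1, ht.2.le.trans hmem.1.2⟩, hbad⟩
    linarith [ht.2]

/-! ## §3 The deep approximant of the first exit -/

section Deep

variable {𝓢 : Spacetime.{0} 4} {O : Set 𝓢.carrier} {k : ℕ}

/-- A d.o.c.-part coordinate of hole `i` has Kerr–Schild coordinates: `P⁻¹ y = Θᵢ x`, `x ∈ Kerr.exterior`. [folklore] -/
private theorem exists_kerr_of_mem_docPart_w8 (d : StationaryFinalStateDecomposition 𝓢 O k) {M a c r₀ : Fin d.N → ℝ}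
    {Θ : Fin d.N → E4 → E4} {i : Fin d.N}
    (hW : IsKerrChartedWith (d.hole i) (d.adapted i) (M i) (a i) (c i) (r₀ i) (Θ i))
    {y : (d.background i).domain} (hy : y ∈ docPart d i) :
    ∃ x ∈ (Kerr.exterior (M i) (a i) : Set E4), Θ i x = poincareInv (d.motion i).1 (d.motion i).2 y.1 := by
  -- private copy of `exists_kerr_of_mem_docPart` (…RecutCoreCOFlatSteer, p146004, unbuilt today)
  have h : poincareInv (d.motion i).1 (d.motion i).2 y.1 ∈ Θ i '' (Kerr.exterior (M i) (a i) : Set E4) := by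
    rw [hW.2.2.2.2.2.2.2.2.2.1]; exact hy
  obtain ⟨x, hx, hxy⟩ := h
  exact ⟨x, hx, hxy⟩

/-- `(y + t e₀)⁰ = y⁰ + t`. [folklore] -/
private theorem add_smul_basisVector_apply_zero_w8 (y : E4) (t : ℝ) :
    (y + t • E4.basisVector 0) 0 = y 0 + t := by
  simp [E4.basisVector]

/-- `|u⁰| ≤ ‖u‖`. [folklore] -/
private theorem abs_apply_zero_le_norm_w8 (u : E4) : |u 0| ≤ ‖u‖ := by
  refine abs_le_of_sq_le_sq ?_ (norm_nonneg _)
  rw [E4.norm_sq_eq_time_sq_add u]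
  nlinarith [E4.spatialNorm_nonneg u]

/-- **Registered helper `recutJunction_deepApproximant` (deep-exit plumbing of Step F, one-approximant form, B3 in the
landed deep form).** See the module docstring. Dafermos–Luk arXiv:1710.01722, Conjecture 1 (b)–(c). [folklore] -/
theorem recutJunction_deepApproximant : ∀ {𝓢 : Spacetime.{0} 4} {O : Set 𝓢.carrier} {k : ℕ} (d : StationaryFinalStateDecomposition 𝓢 O k) (M a c r₀ : Fin d.N → ℝ) (Θ : Fin d.N → E4 → E4) (R : Fin d.N → ℝ → ℝ), (∀ i, Monotone (R i)) → (∀ W s₀ : ℝ, ∀ᶠ τ in atTop, ∀ y : E4, y 0 = τ → y ∉ (d.toOver.flatDomain : Set E4) → ∃ i, (d.background i).radius y ≤ R i ((d.background i).time y - s₀) - W) → (∀ i, IsKerrChartedWith (d.hole i) (d.adapted i) (M i) (a i) (c i) (r₀ i) (Θ i)) → (∀ (i : Fin d.N) (y : (d.background i).domain) (h : (y : E4) ∈ d.toOver.flatDomain), d.toOver.τ₀ < (d.background i).time y.1 → d.toOver.τ₀ < (y : E4) 0 → (d.background i).radius y.1 ≤ R i ((d.background i).time y.1) → d.toOver.chart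 i y = d.toOver.flatChart ⟨y, h⟩) → (∀ y : d.toOver.flatDomain, d.toOver.τ₀ < (y : E4) 0 → ∀ i : Fin d.N, ∃ h : (y : E4) ∈ (d.background i).domain, (⟨(y : E4), h⟩ : (d.background i).domain) ∈ docPart d i) → (∀ i : Fin d.N, ∃ T : ℝ, ∀ y : E4, T ≤ y 0 → (d.background i).radius y ≤ R i ((d.background i).time y) → (d.background i).time y ≤ y 0 + |(d.motion i).2 0| + 1) → (∀ (i : Fin d.N) (Tstar : ℝ), ∃ T : ℝ, ∀ y : E4, T ≤ y 0 → (d.background i).radius y ≤ R i ((d.background i).time y) → Tstar ≤ (d.background i).time y) → (∀ i : Fin d.N, ∃ W₀ : ℝ, ∀ Rstar : ℝ, ∃ T : ℝ, ∀ (s₀ W : ℝ) (y : (d.background i).domain) (h : (y : E4) ∈ d.toOver.flatDomain), 0 < s₀ → W₀ ≤ W → T ≤ (y : E4) 0 → (d.background i).radius y.1 ≤ R i ((d.background i).time y.1 - s₀) - W → y ∈ docPart d i → Rstar ≤ (d.background i).radius y.1) → ∀ s₀ W₀ Tstar Rstar : ℝ, 0 ≤ s₀ → 0 ≤ W₀ →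 ∃ T : ℝ, d.toOver.τ₀ < T ∧ ∀ (τ₁ : ℝ) (y : d.toOver.flatDomain), T ≤ (y : E4) 0 → (y : E4) 0 ≤ τ₁ → (∃ t ∈ Set.Icc (0 : ℝ) (τ₁ - (y : E4) 0), (y : E4) + t • E4.basisVector 0 ∉ (d.toOver.flatDomain : Set E4)) → ∃ (i : Fin d.N) (t : ℝ) (x : E4), 0 ≤ t ∧ (y : E4) 0 + t ≤ τ₁ ∧ (∀ t' ∈ Set.Icc (0 : ℝ) t, (y : E4) + t' • E4.basisVector 0 ∈ (d.toOver.flatDomain : Set E4)) ∧ x ∈ (Kerr.exterior (M i) (a i) : Set E4) ∧ ((d.motion i).1 : E4 ≃L[ℝ] E4) (Θ i x) + (d.motion i).2 = (y : E4) + t • E4.basisVector 0 ∧ Rstar ≤ Kerr.radius (a i) x ∧ Tstar ≤ Θ i x 0 ∧ (d.adapted i).radius (Θ i x) ≤ R i (Θ i x 0 - s₀) - W₀ ∧ Θ i x 0 ≤ (y : E4) 0 + t + |(d.motion i).2 0| + 1 ∧ ∀ (h : (y : E4) + t • E4.basisVector 0 ∈ (d.background i).domain) (h' : (y : E4) + t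 • E4.basisVector 0 ∈ (d.toOver.flatDomain : Set E4)), d.toOver.chart i ⟨(y : E4) + t • E4.basisVector 0, h⟩ = d.toOver.flatChart ⟨(y : E4) + t • E4.basisVector 0, h'⟩ := by
  intro 𝓢 O k d M a c r₀ Θ R hRmono hRiiic hW hRa he hB1b hB1c hB3 s₀ W₀ Tstar Rstar hs₀ hW₀
  -- constants of the identifications and of the adapted radii
  have hglob := fun i ↦ kerrChartedWith_global_bounds (hW i)
  choose L₁ hL₁0 hL₁ using hglob
  choose Cr hCr using fun i ↦ (d.adapted i).exists_abs_radius_sub_spatialNorm_le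
  obtain ⟨Cm', hCm'⟩ := Finite.exists_le fun i : Fin d.N ↦ |Cr i|
  set Cm : ℝ := max Cm' 0 with hCm_def
  have hCm0 : 0 ≤ Cm := le_max_right _ _
  have hCmi : ∀ i, |Cr i| ≤ Cm := fun i ↦ (hCm' i).trans (le_max_left _ _)
  -- brick B3 (deep form): margins `WB i`, thresholds `T₃ i` for the request `Rstar + L₁ i`
  choose WB hWB using hB3
  have hB3' := fun i ↦ hWB i (Rstar + L₁ i)
  choose T₃ hT₃ using hB3'
  obtain ⟨WBm', hWBm'⟩ := Finite.exists_le fun i : Fin d.N ↦ |WB i|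
  set WBm : ℝ := max WBm' 0 with hWBm_def
  have hWBm0 : 0 ≤ WBm := le_max_right _ _
  have hWBi : ∀ i, WB i ≤ WBm := fun i ↦ (le_abs_self _).trans ((hWBm' i).trans (le_max_left _ _))
  -- the rest-time request and the lab-time thresholds of B1c, B1b
  set Ts : ℝ := max Tstar (d.toOver.τ₀ + 1) with hTs_def
  have hTs1 : Tstar ≤ Ts := le_max_left _ _
  have hTs2 : d.toOver.τ₀ + 1 ≤ Ts := le_max_right _ _
  have hB1c' := fun i ↦ hB1c i Ts
  choose Tc hTc using hB1c'
  choose Tb hTb using hB1b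
  obtain ⟨Tfin, hTfin⟩ := Finite.exists_le fun i ↦ max (max (Tc i) (Tb i)) (T₃ i)
  -- clause (iii-c) at the enlarged margins
  obtain ⟨Tic, hTic⟩ := eventually_atTop.1 (hRiiic (W₀ + WBm + 2 * Cm + 1) (s₀ + 2))
  set T : ℝ := max (max Tic (d.toOver.τ₀ + 1)) Tfin with hT_def
  have hT1 : Tic ≤ T := (le_max_left _ _).trans (le_max_left _ _)
  have hT2 : d.toOver.τ₀ + 1 ≤ T := (le_max_right _ _).trans (le_max_left _ _)
  have hT3 : ∀ i, Tc i ≤ T ∧ Tb i ≤ T ∧ T₃ i ≤ T := fun i ↦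
    ⟨((le_max_left _ _).trans (le_max_left _ _)).trans ((hTfin i).trans (le_max_right _ _)),
      ((le_max_right _ _).trans (le_max_left _ _)).trans ((hTfin i).trans (le_max_right _ _)),
      (le_max_right _ _).trans ((hTfin i).trans (le_max_right _ _))⟩
  refine ⟨T, by linarith, fun τ₁ y hTy hyτ hex ↦ ?_⟩
  -- §A the first exit
  obtain ⟨tₑ, htₑ0, htₑb, hIco, hye⟩ := exists_firstExit_w8 d.toOver.flatDomain.isOpen y.2 hex
  set ye : E4 := (y : E4) + tₑ • E4.basisVector 0 with hye_def
  have hye0 : ye 0 = (y : E4) 0 + tₑ := add_smul_basisVector_apply_zero_w8 _ _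
  -- §B clause (iii-c): `ye` is deep for some hole `i`
  obtain ⟨i, hdeep'⟩ := hTic (ye 0) (by rw [hye0]; linarith) ye rfl hye
  obtain ⟨hTci, hTbi, hT₃i⟩ := hT3 i
  have htime : ∀ z : E4, (d.background i).time z = poincareInv (d.motion i).1 (d.motion i).2 z 0 := fun z ↦ rfl
  have hrad : ∀ z : E4, (d.background i).radius z =
      (d.adapted i).radius (poincareInv (d.motion i).1 (d.motion i).2 z) := fun z ↦ rfl
  set σe : ℝ := (d.background i).time ye with hσe
  have hCi1 : ∀ z : E4, (d.adapted i).radius z ≤ E4.spatialNorm z + Cm := fun z ↦ by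
    have h := (abs_le.1 (hCr i z)).2; linarith [le_abs_self (Cr i), hCmi i]
  have hCi2 : ∀ z : E4, E4.spatialNorm z ≤ (d.adapted i).radius z + Cm := fun z ↦ by
    have h := (abs_le.1 (hCr i z)).1; linarith [le_abs_self (Cr i), hCmi i]
  -- §C the approximant `yt = y + t e₀`, `t = tₑ − η`
  set v : E4 := ((d.motion i).1 : E4 ≃L[ℝ] E4).symm (E4.basisVector 0) with hv_def
  set η : ℝ := min (1 / (‖v‖ + 1)) tₑ with hη_def
  have hη0 : 0 < η := lt_min (by positivity) htₑ0
  have hηt : η ≤ tₑ := min_le_right _ _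
  have hη1 : η * (‖v‖ + 1) ≤ 1 := by
    have h1 : η ≤ 1 / (‖v‖ + 1) := min_le_left _ _
    have h2 : 0 < ‖v‖ + 1 := by positivity
    calc η * (‖v‖ + 1) ≤ 1 / (‖v‖ + 1) * (‖v‖ + 1) := by nlinarith
      _ = 1 := by field_simp
  set t : ℝ := tₑ - η with ht_def
  have ht0 : 0 ≤ t := by rw [ht_def]; linarith
  have httₑ : t < tₑ := by rw [ht_def]; linarith
  set yt : E4 := (y : E4) + t • E4.basisVector 0 with hyt_def
  have hyt0 : yt 0 = (y : E4) 0 + t := add_smul_basisVector_apply_zero_w8 _ _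
  have hseg : ∀ t' ∈ Icc (0 : ℝ) t, (y : E4) + t' • E4.basisVector 0 ∈ (d.toOver.flatDomain : Set E4) :=
    fun t' ht' ↦ hIco t' ⟨ht'.1, ht'.2.trans_lt httₑ⟩
  have hytU : yt ∈ (d.toOver.flatDomain : Set E4) := hseg t ⟨ht0, le_rfl⟩
  have hytlab : d.toOver.τ₀ < yt 0 := by rw [hyt0]; linarith
  -- the rest-frame displacement is small
  have hPadd : poincareInv (d.motion i).1 (d.motion i).2 yt =
      poincareInv (d.motion i).1 (d.motion i).2 ye + (t - tₑ) • v := by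
    have h1 : yt = ye + (t - tₑ) • ((d.motion i).1 : E4 ≃L[ℝ] E4) v := by
      rw [hv_def, ContinuousLinearEquiv.apply_symm_apply, hye_def, hyt_def, add_assoc, ← add_smul]
      congr 2; ring
    rw [h1, poincareInv_add_smul]
  have hsmall : ‖(t - tₑ) • v‖ ≤ 1 := by
    rw [norm_smul, Real.norm_eq_abs, abs_of_nonpos (by linarith), neg_sub]
    have h1 : tₑ - t = η := by rw [ht_def]; ring
    rw [h1]
    nlinarith [norm_nonneg v, hη1]
  have hdiff : poincareInv (d.motion i).1 (d.motion i).2 yt - poincareInv (d.motion i).1 (d.motion i).2 ye =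
      (t - tₑ) • v := by
    rw [hPadd, add_sub_cancel_left]
  have hσt1 : |(d.background i).time yt - σe| ≤ 1 := by
    rw [htime, hσe, htime, ← PiLp.sub_apply, hdiff]
    exact (abs_apply_zero_le_norm_w8 _).trans hsmall
  have hσt := abs_le.1 hσt1
  have hsp : E4.spatialNorm (poincareInv (d.motion i).1 (d.motion i).2 yt) ≤
      E4.spatialNorm (poincareInv (d.motion i).1 (d.motion i).2 ye) + 1 := by
    have h := (abs_le.1 (E4.abs_spatialNorm_sub_le (poincareInv (d.motion i).1 (d.motion i).2 yt)
      (poincareInv (d.motion i).1 (d.motion i).2 ye))).2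
    rw [hdiff] at h
    linarith
  have hradt : (d.background i).radius yt ≤ (d.background i).radius ye + 2 * Cm + 1 := by
    rw [hrad, hrad]
    linarith [hCi1 (poincareInv (d.motion i).1 (d.motion i).2 yt), hCi2 (poincareInv (d.motion i).1 (d.motion i).2 ye)]
  -- deepness of the approximant at the B3 margins and at `(s₀, W₀)`; certification
  have hdeepB : (d.background i).radius yt ≤ R i ((d.background i).time yt - (s₀ + 1)) - (W₀ + WBm) := by
    have hm : R i (σe - (s₀ + 2)) ≤ R i ((d.background i).time yt - (s₀ + 1)) := hRmono i (by linarith)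
    linarith
  have hdeept : (d.background i).radius yt ≤ R i ((d.background i).time yt - s₀) - W₀ := by
    have hm : R i ((d.background i).time yt - (s₀ + 1)) ≤ R i ((d.background i).time yt - s₀) :=
      hRmono i (by linarith)
    linarith
  have hcertt : (d.background i).radius yt ≤ R i ((d.background i).time yt) := by
    have hm : R i ((d.background i).time yt - s₀) ≤ R i ((d.background i).time yt) := hRmono i (by linarith)
    linarith
  -- B1c, B1b at the approximant
  have hrestT : Ts ≤ (d.background i).time yt := hTc i yt (by rw [hyt0]; linarith) hcertt
  have hrestt : d.toOver.τ₀ < (d.background i).time yt := by linarith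
  have hB1bt : (d.background i).time yt ≤ yt 0 + |(d.motion i).2 0| + 1 := hTb i yt (by rw [hyt0]; linarith) hcertt
  -- (e⁺): a d.o.c.-part coordinate of hole `i`, with Kerr–Schild point `x'`
  obtain ⟨hdomt, hdoct⟩ := he ⟨yt, hytU⟩ hytlab i
  obtain ⟨x', hx', hΘx'⟩ := exists_kerr_of_mem_docPart_w8 d (hW i) hdoct
  have hΘ0 : Θ i x' 0 = (d.background i).time yt := by rw [htime, ← hΘx']
  have hΘr : (d.adapted i).radius (Θ i x') = (d.background i).radius yt := by rw [hrad, ← hΘx']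
  -- B3: far from the hole
  have hfar : Rstar + L₁ i ≤ (d.background i).radius yt :=
    hT₃ i (s₀ + 1) (W₀ + WBm) ⟨yt, hdomt⟩ hytU (by linarith) (by linarith [hWBi i]) (by rw [hyt0]; linarith)
      hdeepB hdoct
  have hρx' : Rstar ≤ Kerr.radius (a i) x' := by
    have h := (hL₁ i x' hx').2.1
    rw [hΘr] at h; linarith
  refine ⟨i, t, x', ht0, by linarith, hseg, hx', ?_, hρx', ?_, ?_, ?_, fun h h' ↦ ?_⟩
  · rw [hΘx', apply_poincareInv_add]
  · rw [hΘ0]; linarith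
  · rw [hΘr, hΘ0]; exact hdeept
  · rw [hΘ0, ← hyt0]; exact hB1bt
  · exact hRa i ⟨yt, h⟩ h' hrestt hytlab hcertt

end Deep

end Summit.FinalStateConjecture.FinalStateConjecture.Theorems.SymplecticDualOfTheBomb

end
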